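import Literature.NumberTheory.EllipticCurves.Sprung2012.ColemanPairExistsProofs
import Literature.NumberTheory.EllipticCurves.Sprung2012.ColemanTwistProofs
import Literature.NumberTheory.EllipticCurves.Sprung2012.LocalIwasawaModule
import Literature.NumberTheory.EllipticCurves.PlusMinusPAdicLFunctionProofs
import HarnessLib

/-!
# Sprung 2012 §§2, 5, 7: the JOINT Coleman map `Col = (Col♯, Col♭) : H¹_Iw(T) → Λ ⊕ Λ` is INJECTIVE — proofs only,
# in the tree's transcription (`ColemanMaps.lean`: `H¹_Iw(T)` = functionals on `E(K_∞·K_v)`, `Col(z) = (L♯, L♭)` iff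
# `IsColemanPair`, Honda systems = `IsHondaSystem`)

Topic `Literature/NumberTheory/EllipticCurves`, cluster `Sprung2012` (namespace = path). A THEOREMS file (no definition, no
named fact; net Literature debt `0`). Cell `bsd-ssimc`, width seat `cruxlead-stmt-BirchSwinnertonDyer-19875-w3` (gen 6), in
support of the x8 cruxes stmt-BirchSwinnertonDyer-22569 `KatoFineLowerSporadicX8` / 22901 `CyclotomicLowerPosLevelX8` through
the COKERNEL BOUND F-α of the ledger doors (`Summits/…/Theorems/SignedLowerHalvesSprungLowerDivisibilityAtThree{KatoSporadicLedgerDoor,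
OffTLedgerDoor,CokerBoundSkeleton}.lean`): the skeleton `min_lengthAt_quotient_range_le_lengthAt_torsion_of_skeleton` needs the
joint Coleman map `J : P → Λ²` INJECTIVE with cokernel of length `0` off `(T)` (Kurihara–Pollack 2007 Prop. 1.2 for `a_p = 0`;
Lei–Sujatha 2021 (SES-KP) «`0 → H¹_Iw(ℚ_p, T) → Λ² → ℤ_p → 0` as given by [KP] and [Sprung]»; Sprung 2012 §7.1 prints the
INDIVIDUAL surjectivities Props. 7.3/7.6 only). THIS FILE proves the INJECTIVITY half in the tree's functional model, from the
Honda relations alone (Thm. 2.2 / Cor. 2.10 in the dual form of `IsHondaSystem`: at each level `n ≥ 1` a functional on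
`E(K_n·K_v)` with `P_{n,c_n}(z) ≡ P_{n,c_{n−1}}(z) ≡ 0 (mod ω_n)` vanishes):

* `IsColemanPair.eq_zero_of_pair_zero` — **`Col(z) = (0, 0) ⟹ z = 0`**: from `IsColemanPair … z 0 0`, at every level
  `ω_n ∣ P_{n,c_n}(z)`; LEVEL RAISING (`thetaPoly_succ_of_mem_layer`, Sprung Prop. 5.5: `P_{n+1,x} = Φ_{p^{n+1}}(1+T)·P_{n,x}`
  for `x` of level `n`) and `ω_{n+1} = ω_n·Φ_{p^{n+1}}(1+T)` give `ω_{n+1} ∣ P_{n+1,c_n}(z)` too; the generation clause of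
  the Honda system at level `n+1` kills the restriction of `z` to `E(K_{n+1}·K_v)`; and `E(K_∞·K_v) = ⋃_n E(K_n·K_v)`.
* `IsColemanPair.functional_unique` — **two functionals with the same Coleman value are equal** (`IsColemanPair.sub`).
HONEST FRAMING: the cokernel half of (SES-KP) (`T·Λ² ⊆ Col(H¹_Iw)`, image mod `T` = the line spanned by
`(a_p(a_p−2) − (p−1), a_p − 2)`) is NOT proved here; nothing about any curve's Selmer group or BSD is asserted. Hypotheses: a
local element `g` restricting to the chosen topological generator and a Honda system — no parity / supersingularity input is
used by the injectivity argument itself (they are hypotheses of the EXISTENCE of Honda systems, Thm. 2.2).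

References: [Sprung2012] Thm. 2.2, Cor. 2.10 (pp. 1487–1489), Def. 3.1 (p. 1489), Prop. 5.5, Def. 5.9 (pp. 1494–1495), Def. 7.1,
Lemmas 7.4–7.5 (p. 1500); [KuriharaPollack2007] Prop. 1.2; [LeiSujatha2021] §3 (SES-KP); [Kobayashi2003] Prop. 8.12, Lemma 8.15;
tree: `Sprung2012/{ColemanMaps, ColemanPairExistsProofs (thetaPoly_succ_of_mem_layer), ColemanTwistProofs (IsColemanPair.sub),
ColemanMapLambdaActionProofs (smul_mem_localLayerPointsOfEmb), LocalIwasawaModule (level), LocalTowerLayersProofs}.lean`,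
`PlusMinusPAdicLFunctionProofs` (`cyclotomicOmega_succ`), `Kobayashi2003/SignedSelmer` (`localLayerPointsOfEmb_mono`).
-/

noncomputable section

open scoped Classical NumberField

open NumberField IsDedekindDomain Polynomial WeierstrassCurve Literature.NumberTheory.EllipticCurves
  Literature.NumberTheory.EllipticCurves.ZpExtension Literature.NumberTheory.EllipticCurves.Sprung2017
  Literature.NumberTheory.EllipticCurves.Kobayashi2003

universe u

namespace Literature.NumberTheory.EllipticCurves.Sprung2012

section Injective

variable {K : Type u} [Field K] {p : ℕ} [Fact p.Prime] (κ : ZpExtension K p)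
variable {E : Type u} [Field E] [Algebra K E] (ι : AlgebraicClosure K →ₐ[K] AlgebraicClosure E)
variable (W : WeierstrassCurve K)

/-- `↑(Θ_n(x, z)) = P_{n,x}(z)` in `Λ` for every point `x` (plumbing; = `coe_colemanTheta` for `x = c_n`).
[cite: Sprung2012, Def. 3.1 (p. 1489)] -/
theorem coe_thetaPoly (g : Field.absoluteGaloisGroup E) (n : ℕ) (x : localPoints W E)
    (z : localTowerPointsOfEmb κ ι W →+ ℤ_[p]) :
    ((thetaPoly κ ι W g n x z : ℤ_[p][X]) : PowerSeries ℤ_[p]) =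
      pairingSum W (localTowerPointsOfEmb κ ι W) g n x z := by
  rw [thetaPoly, pairingSum_def, ← Polynomial.coeToPowerSeries.ringHom_apply, map_sum]
  refine Finset.sum_congr rfl fun j _ => ?_
  rw [Polynomial.coeToPowerSeries.ringHom_apply, Polynomial.coe_mul, Polynomial.coe_pow,
    Polynomial.coe_add, Polynomial.coe_one, Polynomial.coe_C, Polynomial.coe_X]

/-- **Restriction to a layer does not change the pairing sums of points of that layer**: for `x ∈ E(K_n·K_v)` (whose
`Γ`-orbit stays in the layer) and a functional `z` on `E(K_∞·K_v)`, `P_{m,x}(z|_{E(K_n·K_v)}) = P_{m,x}(z)`.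
[cite: Sprung2012, Def. 3.1 (p. 1489), Lemma 7.10 (p. 1503)] -/
theorem pairingSum_comp_inclusion (n : ℕ) {x : localPoints W E} (hx : x ∈ localLayerPointsOfEmb κ ι W n)
    (g : Field.absoluteGaloisGroup E) (m : ℕ) (z : localTowerPointsOfEmb κ ι W →+ ℤ_[p]) :
    pairingSum W (localLayerPointsOfEmb κ ι W n) g m x
        (z.comp (AddSubgroup.inclusion (localLayerPointsOfEmb_le_localTowerPointsOfEmb κ ι W n))) =
      pairingSum W (localTowerPointsOfEmb κ ι W) g m x z := by
  refine Finset.sum_congr rfl fun j _ => ?_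
  have hj : g ^ j • x ∈ localLayerPointsOfEmb κ ι W n := smul_mem_localLayerPointsOfEmb κ ι W n _ hx
  have hjT : g ^ j • x ∈ localTowerPointsOfEmb κ ι W := localLayerPointsOfEmb_le_localTowerPointsOfEmb κ ι W n hj
  rw [evalOn_of_mem W _ _ hj, evalOn_of_mem W _ _ hjT, AddMonoidHom.comp_apply]
  rfl

variable {κ ι W}

/-- **THE JOINT COLEMAN MAP IS INJECTIVE: `Col(z) = (0, 0) ⟹ z = 0`** (the first arrow of the exact sequence
`0 → H¹_Iw(ℚ_p, T) → Λ² → ℤ_p → 0` of Kurihara–Pollack / Lei–Sujatha (SES-KP), in Sprung's ♯/♭ setting and the tree's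
functional model). Hypotheses: `g` restricts to the topological generator, `(cneg, c)` is a Honda system. Proof: level by
level, `ω_n ∣ P_{n,c_n}(z)` (the Coleman condition with `(L♯, L♭) = (0,0)`) and `ω_{n+1} ∣ Φ_{p^{n+1}}(1+T)·P_{n,c_n}(z) =
P_{n+1,c_n}(z)` (level raising), so the Honda generation clause at level `n+1` kills `z` on `E(K_{n+1}·K_v)`; every point
of `E(K_∞·K_v)` has a level. [cite: Sprung2012, Thm. 2.2 and Cor. 2.10 (pp. 1487–1489), Prop. 5.5, Def. 5.9 (pp. 1494–1495), Def. 7.1 (p. 1500)]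
[cite: KuriharaPollack2007, Prop. 1.2] [cite: LeiSujatha2021, §3 (SES-KP)] -/
theorem IsColemanPair.eq_zero_of_pair_zero {g : Field.absoluteGaloisGroup E}
    (hg : κ.IsTopGenerator (resGalOfEmb ι g)) {ap : ℤ} {cneg : localPoints W E} {c : ℕ → localPoints W E}
    (hH : IsHondaSystem κ ι W ap g cneg c) {z : localTowerPointsOfEmb κ ι W →+ ℤ_[p]}
    (hz : IsColemanPair κ ι W ap g c z 0 0) : z = 0 := by
  obtain ⟨-, hcn, -, -, -, -, -, hgen, -⟩ := hH
  -- `ω_n ∣ P_{n,c_n}(z)` at every level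
  have hθ : ∀ n, toIwasawa p (cyclotomicOmega p n) ∣ pairingSum W (localTowerPointsOfEmb κ ι W) g n (c n) z := by
    intro n
    simpa only [mul_zero, add_zero] using hz n
  -- hence `ω_{n+1} ∣ P_{n+1,c_n}(z)` (level raising)
  have hθ' : ∀ n, toIwasawa p (cyclotomicOmega p (n + 1)) ∣
      pairingSum W (localTowerPointsOfEmb κ ι W) g (n + 1) (c n) z := by
    intro n
    rw [← coe_thetaPoly, thetaPoly_succ_of_mem_layer κ ι W hg (hcn n) z, Polynomial.coe_mul, cyclotomicOmega_succ,
      map_mul]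
    have hΦ : toIwasawa p ((cyclotomic (p ^ (n + 1)) ℤ).comp (X + 1)) =
        ((((cyclotomic (p ^ (n + 1)) ℤ).comp (X + 1)).map (Int.castRingHom ℤ_[p]) : ℤ_[p][X]) : PowerSeries ℤ_[p]) :=
      rfl
    rw [hΦ, mul_comm, coe_thetaPoly]
    exact mul_dvd_mul_left _ (hθ n)
  -- the restriction of `z` to each layer `n + 1` vanishes
  have hlayer : ∀ n, z.comp (AddSubgroup.inclusion (localLayerPointsOfEmb_le_localTowerPointsOfEmb κ ι W (n + 1))) = 0 := by
    intro n
    refine hgen (n + 1) (Nat.le_add_left 1 n) _ ?_ ?_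
    · rw [pairingSum_comp_inclusion κ ι W (n + 1) (hcn (n + 1))]
      exact hθ (n + 1)
    · rw [Nat.add_sub_cancel,
        pairingSum_comp_inclusion κ ι W (n + 1) (localLayerPointsOfEmb_mono κ ι W (Nat.le_succ n) (hcn n))]
      exact hθ' n
  -- every point of the tower lies in some layer `n + 1`
  ext P
  obtain ⟨n, hn⟩ := exists_mem_localLayerPointsOfEmb_of_mem_localTowerPointsOfEmb κ ι W P.2
  have hn1 : (P : localPoints W E) ∈ localLayerPointsOfEmb κ ι W (n + 1) :=
    localLayerPointsOfEmb_mono κ ι W (Nat.le_succ n) hn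
  have h := DFunLike.congr_fun (hlayer n) ⟨P, hn1⟩
  rw [AddMonoidHom.comp_apply, AddMonoidHom.zero_apply] at h
  rw [AddMonoidHom.zero_apply, ← h]
  rfl

/-- **Two functionals with the same Coleman value coincide** (injectivity of `Col : H¹_Iw(T) → Λ ⊕ Λ`).
[cite: Sprung2012, Def. 5.9 (p. 1495), Def. 7.1 (p. 1500), Cor. 2.10 (p. 1489)] [cite: LeiSujatha2021, §3 (SES-KP)] -/
theorem IsColemanPair.functional_unique {g : Field.absoluteGaloisGroup E}
    (hg : κ.IsTopGenerator (resGalOfEmb ι g)) {ap : ℤ} {cneg : localPoints W E} {c : ℕ → localPoints W E}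
    (hH : IsHondaSystem κ ι W ap g cneg c) {z z' : localTowerPointsOfEmb κ ι W →+ ℤ_[p]}
    {Lsharp Lflat : IwasawaAlgebra p} (hz : IsColemanPair κ ι W ap g c z Lsharp Lflat)
    (hz' : IsColemanPair κ ι W ap g c z' Lsharp Lflat) : z = z' := by
  have h := hz.sub hz'
  rw [sub_self, sub_self] at h
  exact sub_eq_zero.mp (IsColemanPair.eq_zero_of_pair_zero hg hH h)

end Injective

end Literature.NumberTheory.EllipticCurves.Sprung2012

end
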